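import Summits.CriticalPhenomena.SAWScalingLimit.Theses.SAWLoopFugacityFlow
import Literature.Probability.RandomPlanarGeometry.SAWSideProbability

/-!
# Negative-side results for the crux `SAWLoopFugacityFlow.SimpleSubseqLimits` (stmt-CriticalPhenomena-4982):
HONESTY of the critical SAW laws along a weakly convergent sequence (work-file §0–§1).

The crux (shared verbatim by SAWSteinDefect / SAWTensorRG / SAWFrontierHomotopy):
`∀ D a b, IsEndpointApprox D a b → ∀ s ν, s → 0⁺ → IsProbabilityMeasure ν →
(∀ f : CurveClass ℂ →ᵇ ℝ, ∫ f ∘ curve dP_{s n} → ∫ f dν) → ν-a.e. γ is simple, from a to b, in cl D,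
meeting ∂D only at a, b`, `P_δ = SAW.law D.carrier δ (a δ) (b δ)`.

Here: the total mass of `SAW.law` is `0` or `1`; the weak-convergence hypothesis forces `P_{s n}` to be
a probability measure (and the endpoints to be joined in `Ω_{s n}`) for all large `n` — every junk
regime of the law kills the HYPOTHESES of the crux, never its conclusion, and the field
`IsEndpointApprox.reachable` is idle along the sequence.

Refuter `cdisprove` (standing adversary); the full indexed work file is
`Summits/CriticalPhenomena/SAWScalingLimit/Cruxes/SimpleSubseqLimits/Disproof.lean`.
-/

noncomputable section

open MeasureTheory Filter Topology Set Metric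
open Literature.Probability.RandomPlanarGeometry Literature.Probability.RandomPlanarGeometry.SAW
open Literature.Probability.LatticeModels
open scoped ENNReal NNReal BoundedContinuousFunction

namespace Summit.CriticalPhenomena.SAWScalingLimit.Theorems.SimpleSubseqLimits.Negative

open Summit.CriticalPhenomena.SAWScalingLimit.Theses.SAWLoopFugacityFlow (SimpleSubseqLimits)

/-! ## §0 Read-back -/

/-- The full carrier predicate of the crux's conclusion (verbatim). [folklore] -/
def Carrier (D : DobrushinDomain) (γ : CurveClass ℂ) : Prop :=
  γ ∈ CurveClass.simple ∧ γ.source = D.pt 0 ∧ γ.target = D.pt 1 ∧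
    γ.range ⊆ closure D.carrier ∧ γ.range ∩ frontier D.carrier ⊆ {D.pt 0, D.pt 1}

/-- The weak-convergence hypothesis of the crux along a sequence of meshes (verbatim): the test
integrals of the critical SAW laws converge to those of `ν`. [folklore] -/
def WeakLimitAlong (D : DobrushinDomain) (a b : ℝ → Site 2) (s : ℕ → ℝ)
    (ν : Measure (CurveClass ℂ)) : Prop :=
  ∀ f : CurveClass ℂ →ᵇ ℝ,
    Tendsto (fun n => ∫ γ, f γ.curve ∂(law D.carrier (s n) (a (s n)) (b (s n)))) atTop
      (𝓝 (∫ x, f x ∂ν))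

/-- Read-back: the crux in terms of `WeakLimitAlong` and `Carrier` (definitional). [folklore] -/
theorem simpleSubseqLimits_iff : SimpleSubseqLimits ↔
    ∀ (D : DobrushinDomain) (a b : ℝ → Site 2), IsEndpointApprox D a b →
      ∀ (s : ℕ → ℝ) (ν : Measure (CurveClass ℂ)), Tendsto s atTop (𝓝[>] (0 : ℝ)) →
        IsProbabilityMeasure ν → WeakLimitAlong D a b s ν → ∀ᵐ γ ∂ν, Carrier D γ :=
  Iff.rfl

/-! ## §1 Honesty of the laws along a weakly convergent sequence -/

section Honesty

variable {Ω : Set ℂ} {δ : ℝ} {a b : Site 2}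

/-- The critical SAW law has total mass `0` (junk: no SAW, or infinite partition function) or `1`.
[folklore] -/
theorem law_univ_eq_zero_or_one (Ω : Set ℂ) (δ : ℝ) (a b : Site 2) :
    law Ω δ a b univ = 0 ∨ law Ω δ a b univ = 1 := by
  rw [law, Measure.smul_apply, smul_eq_mul]
  rcases eq_or_ne (weight Ω δ a b univ) 0 with h0 | h0
  · left; rw [h0, mul_zero]
  rcases eq_or_ne (weight Ω δ a b univ) ∞ with ht | ht
  · left; rw [ht, ENNReal.inv_top, zero_mul]
  · right; exact ENNReal.inv_mul_cancel h0 ht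

/-- The critical SAW law is a finite measure (total mass `≤ 1`). [folklore] -/
instance isFiniteMeasure_law (Ω : Set ℂ) (δ : ℝ) (a b : Site 2) :
    IsFiniteMeasure (law Ω δ a b) :=
  ⟨(law_apply_le_one Ω δ a b univ).trans_lt ENNReal.one_lt_top⟩

/-- The law is a probability measure as soon as its total mass is not `0`. [folklore] -/
theorem isProbabilityMeasure_law_of_ne_zero (h : law Ω δ a b univ ≠ 0) :
    IsProbabilityMeasure (law Ω δ a b) :=
  ⟨(law_univ_eq_zero_or_one Ω δ a b).resolve_left h⟩

/-- A nonzero law charges some SAW, so the endpoints are joined in `Ω_δ`. [folklore] -/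
theorem reachable_of_law_ne_zero (h : law Ω δ a b univ ≠ 0) :
    (discreteDomainGraph Ω δ).Reachable a b := by
  by_contra hr
  have : IsEmpty (DomainSAW Ω δ a b) := ⟨fun γ => hr ⟨γ.walk⟩⟩
  exact h (by rw [Set.univ_eq_empty_iff.2 this, measure_empty])

/-- **Honesty along the sequence.** If the SAW laws along `s n` converge weakly (on bounded
continuous test functions of the curve) to a probability measure, then for all large `n` the law
at mesh `s n` is a probability measure and the endpoints `a (s n)`, `b (s n)` are joined in the
discrete domain (test function `f ≡ 1`: the total masses `∈ {0, 1}` converge to `1`). So every junk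
value of `SAW.law` is excluded by the HYPOTHESES of the crux, and `IsEndpointApprox.reachable` is
never needed along the sequence. [folklore] -/
theorem eventually_isProbabilityMeasure_of_weakLimitAlong {D : DobrushinDomain} {a b : ℝ → Site 2}
    {s : ℕ → ℝ} {ν : Measure (CurveClass ℂ)} [IsProbabilityMeasure ν]
    (h : WeakLimitAlong D a b s ν) :
    ∀ᶠ n in atTop, IsProbabilityMeasure (law D.carrier (s n) (a (s n)) (b (s n))) ∧
      (discreteDomainGraph D.carrier (s n)).Reachable (a (s n)) (b (s n)) := by
  have h1 := h 1
  have hl : (fun n => ∫ γ, (1 : CurveClass ℂ →ᵇ ℝ) γ.curve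
      ∂(law D.carrier (s n) (a (s n)) (b (s n)))) =
      fun n => (law D.carrier (s n) (a (s n)) (b (s n)) univ).toReal := by
    funext n; simp [Measure.real]
  have hr : ∫ x, (1 : CurveClass ℂ →ᵇ ℝ) x ∂ν = 1 := by simp
  rw [hl, hr] at h1
  have hev : ∀ᶠ n in atTop,
      (law D.carrier (s n) (a (s n)) (b (s n)) univ).toReal ∈ Ioi (1 / 2 : ℝ) :=
    h1 (Ioi_mem_nhds (by norm_num))
  filter_upwards [hev] with n hn
  have hne : law D.carrier (s n) (a (s n)) (b (s n)) univ ≠ 0 := by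
    intro h0
    rw [h0, ENNReal.toReal_zero, mem_Ioi] at hn
    norm_num at hn
  exact ⟨isProbabilityMeasure_law_of_ne_zero hne, reachable_of_law_ne_zero hne⟩

end Honesty

/-- **A disproof of the crux is an existence statement**: it must EXHIBIT a Dobrushin domain, an
honest endpoint approximation and a subsequential weak limit `ν` of the critical SAW laws (none has
ever been constructed — tightness at `x_c`, item stmt-CriticalPhenomena-1372, is open) violating the
carrier clause; where no subsequential limit exists the crux holds vacuously. [folklore] -/
theorem exists_weakLimitAlong_of_not_simpleSubseqLimits (h : ¬ SimpleSubseqLimits) :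
    ∃ (D : DobrushinDomain) (a b : ℝ → Site 2) (s : ℕ → ℝ) (ν : Measure (CurveClass ℂ)),
      IsEndpointApprox D a b ∧ Tendsto s atTop (𝓝[>] (0 : ℝ)) ∧ IsProbabilityMeasure ν ∧
      WeakLimitAlong D a b s ν ∧ ¬ ∀ᵐ γ ∂ν, Carrier D γ := by
  by_contra hcon
  refine h fun D a b hab s ν hs hν hw => ?_
  by_contra hbad
  exact hcon ⟨D, a, b, s, ν, hab, hs, hν, hw, hbad⟩

end Summit.CriticalPhenomena.SAWScalingLimit.Theorems.SimpleSubseqLimits.Negative
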